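import Summits.QuantumFields.YangMills.Theorems.BalabanLadderNTCouplingSumRuleFloor
import Summits.QuantumFields.YangMills.Theorems.BalabanLadderNTCouplingSumRuleCumulant
import HarnessLib

/-!
# Crux `NT` (stmt-QuantumFields-19353): the zero-momentum THREE-point function of the action density is NEGATIVE, with the
# perturbative power `β⁻³` up to logarithms, somewhere in every coupling window — uniformly in the volume, hypothesis-free

Fleet lead prover of crux `NT` (unit `ym-spine-19353-p1`, g9).  Clause (ii) of `LowerBounds` floors `|Q3| = |Σ f g h κ₃,T|`; its
`why_might_fail` says «Q3's sign is one-loop-hard».  AT ZERO LATTICE MOMENTUM the sign is thermodynamic: with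
`ψ_L(γ; x) := Σ_{y,z ∈ box L} torusK3_{γ,L}(x, y, z) = ∂_γ χ_L(γ; x)` (g8's third-order sum rule `hasDerivAt_torusCov_dens_coupling`
summed over `y`; `χ_L(γ; x) = Σ_z Cov_{T,γ}(A_x, A_z)`), the FLOOR of `Theorems/BalabanLadderNTCouplingSumRuleFloor` (some
`γ_f ∈ [β, Aβ(1+log β)]` has `χ_L(γ_f) ≥ F = c'/(β²(1+log β))`) and g8's CEILING far enough to the right (some `γ_c ∈ [β', 2β']`,
`β' = Nβ(1+log β)`, has `χ_L(γ_c) ≤ F/2`) force `∫_{γ_f}^{γ_c} ψ_L ≤ −F/2`, whence: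

* `hasDerivAt_sum_torusCov_dens_coupling`, `integral_sum_sum_torusK3_eq` — `∂_γ χ_L = ψ_L`, FTC;
* **`exists_sum_sum_torusK3_le_window`** — there are `c₃ > 0`, `B ≥ 1`, `β₀ ≥ 1` with: for every odd torus `2L+1 ≥ 5`, every
  `β ≥ β₀`, every site `x`, SOME `γ ∈ [β, Bβ(1 + log β)]` has **`Σ_{y,z ∈ box L} torusK3_{γ,L}(x, y, z) ≤ −c₃/(β³(1 + log β)²)`**
  (+ `_of_simple` for compact simple `G`).  PT: `ψ_L ≈ ∂_β(3D/(2β²)) = −3D/β³`.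

HONEST FRAMING.  A `k = 0` (all three momenta zero… the `y, z`-summed) statement on window-dense couplings; clause (ii)'s witnesses
are three DISJOINTLY supported bumps at scale `a(β)`, i.e. `|k| ≍ a(β)`, where nothing is claimed; no β-uniform floor, nothing of
NT, the seam or the gap; not Clay.  Refs: Montvay–Münster 1994 §3.2; the crux idea `skewness-from-asymptotic-freedom` §Mechanism 2.
-/

set_option autoImplicit false

noncomputable section

open MeasureTheory Filter Set
open scoped BigOperators
open Literature.MathematicalPhysics.QuantumLattice
open Literature.MathematicalPhysics.QuantumFieldTheory hiding ZdEdge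
open Literature.Probability.LatticeModels (box)
open Summit.QuantumFields.YangMills.Theorems.FreeEnergyLogCoefficient (dimE)
open Summit.QuantumFields.YangMills.Cruxes.OSLegsFromFemtoAndGap.DlrCollarTransfer (torusE dens torusK3)
open Summit.QuantumFields.YangMills.Cruxes.NT.CouplingSumRule (hasDerivAt_torusCov_dens_coupling continuous_sum_torusK3
  continuous_sum_torusCov_dens exists_sum_torusCov_dens_le_window one_add_log_div_antitone)

namespace Summit.QuantumFields.YangMills.Cruxes.NT.LinkEquipartition

section Skew

variable (G : Type) [Group G] [TopologicalSpace G] [IsTopologicalGroup G] [CompactSpace G]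
  [MeasurableSpace G] [BorelSpace G] (r : LatticeRep G)

/-- **`∂_γ χ_L(γ; x) = Σ_{y,z} torusK3_{γ,L}(x, y, z)`** (g8's `hasDerivAt_torusCov_dens_coupling` summed over `y`). [folklore] -/
theorem hasDerivAt_sum_torusCov_dens_coupling (β : ℝ) (L : ℕ) (x : Fin 4 → ℤ) :
    HasDerivAt (fun γ => ∑ z ∈ box 4 L,
        (torusE G r γ L (fun U => dens G r x U * dens G r z U) - torusE G r γ L (dens G r x) * torusE G r γ L (dens G r z)))
      (∑ y ∈ box 4 L, ∑ z ∈ box 4 L, torusK3 G r β L x y z) β :=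
  HasDerivAt.fun_sum fun y _ => hasDerivAt_torusCov_dens_coupling G r β L x y

/-- `γ ↦ Σ_{y,z} torusK3_{γ,L}(x, y, z)` is continuous. [folklore] -/
theorem continuous_sum_sum_torusK3 (L : ℕ) (x : Fin 4 → ℤ) :
    Continuous fun γ => ∑ y ∈ box 4 L, ∑ z ∈ box 4 L, torusK3 G r γ L x y z :=
  continuous_finsetSum _ fun y _ => continuous_sum_torusK3 G r L x y

/-- **FTC for the susceptibility**: `∫_{β₁}^{β₂} Σ_{y,z} torusK3_{γ,L}(x,y,z) dγ = χ_L(β₂; x) − χ_L(β₁; x)`. [folklore] -/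
theorem integral_sum_sum_torusK3_eq (L : ℕ) (x : Fin 4 → ℤ) (β₁ β₂ : ℝ) :
    ∫ γ in β₁..β₂, ∑ y ∈ box 4 L, ∑ z ∈ box 4 L, torusK3 G r γ L x y z =
      (∑ z ∈ box 4 L, (torusE G r β₂ L (fun U => dens G r x U * dens G r z U) -
          torusE G r β₂ L (dens G r x) * torusE G r β₂ L (dens G r z))) -
      (∑ z ∈ box 4 L, (torusE G r β₁ L (fun U => dens G r x U * dens G r z U) -
          torusE G r β₁ L (dens G r x) * torusE G r β₁ L (dens G r z))) :=
  intervalIntegral.integral_eq_sub_of_hasDerivAt (fun γ _ => hasDerivAt_sum_torusCov_dens_coupling G r γ L x)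
    ((continuous_sum_sum_torusK3 G r L x).intervalIntegrable _ _)

/-- **THE SIGN OF THE ZERO-MOMENTUM THREE-POINT FUNCTION ON EVERY COUPLING WINDOW.**  There are `c₃ > 0`, `B ≥ 1`, `β₀ ≥ 1`
(depending on `(G, r)` only) such that for every odd torus `2L+1 ≥ 5`, every `β ≥ β₀` and every site `x` some
`γ ∈ [β, Bβ(1 + log β)]` has `Σ_{y,z ∈ box L} torusK3_{γ,L}(x, y, z) ≤ −c₃/(β³(1 + log β)²)`. [folklore] -/
theorem exists_sum_sum_torusK3_le_window (hD : 0 < dimE r.ρ) :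
    ∃ c₃ B β₀ : ℝ, 0 < c₃ ∧ 1 ≤ B ∧ 1 ≤ β₀ ∧ ∀ (L : ℕ), 2 ≤ L → ∀ β : ℝ, β₀ ≤ β → ∀ x : Fin 4 → ℤ,
      ∃ γ ∈ Set.Icc β (B * β * (1 + Real.log β)),
        ∑ y ∈ box 4 L, ∑ z ∈ box 4 L, torusK3 G r γ L x y z ≤ -(c₃ / (β ^ 3 * (1 + Real.log β) ^ 2)) := by
  obtain ⟨c', A, β₀, hc', hA1, hβ₀1, hfl⟩ := exists_sum_torusCov_dens_ge_window G r hD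
  obtain ⟨K, hK0, hceil⟩ := exists_sum_torusCov_dens_le_window G r
  -- the far end of the window: `N = max A M²`, `M = max 1 (72K/c')`
  set M : ℝ := max 1 (72 * K / c') with hM
  have hM1 : 1 ≤ M := le_max_left _ _
  have hM0 : 0 < M := lt_of_lt_of_le one_pos hM1
  have hMK : 72 * K / c' ≤ M := le_max_right _ _
  set N : ℝ := max A (M ^ 2) with hN
  have hNA : A ≤ N := le_max_left _ _
  have hNM : M ^ 2 ≤ N := le_max_right _ _
  have hN1 : 1 ≤ N := hA1.trans hNA
  have hN0 : 0 < N := lt_of_lt_of_le one_pos hN1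
  refine ⟨c' / (4 * N), 2 * N, β₀, by positivity, by linarith, hβ₀1, fun L hL β hβ x => ?_⟩
  have hβ1 : 1 ≤ β := hβ₀1.trans hβ
  have hβ0 : 0 < β := lt_of_lt_of_le one_pos hβ1
  have hlβ : 0 ≤ Real.log β := Real.log_nonneg hβ1
  have h1lβ : 0 < 1 + Real.log β := by linarith
  set χ : ℝ → ℝ := fun γ => ∑ z ∈ box 4 L,
    (torusE G r γ L (fun U => dens G r x U * dens G r z U) - torusE G r γ L (dens G r x) * torusE G r γ L (dens G r z)) with hχ
  set ψ : ℝ → ℝ := fun γ => ∑ y ∈ box 4 L, ∑ z ∈ box 4 L, torusK3 G r γ L x y z with hψ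
  set F : ℝ := c' / (β ^ 2 * (1 + Real.log β)) with hF
  have hFpos : 0 < F := by positivity
  -- the floor point
  obtain ⟨γf, hγf, hfloor⟩ := hfl L hL β hβ x
  -- the ceiling point, in the window `[β', 2β']`, `β' = Nβ(1 + log β)`
  set β' : ℝ := N * β * (1 + Real.log β) with hβ'
  have hβ'ge : A * β * (1 + Real.log β) ≤ β' := by
    rw [hβ']; exact mul_le_mul_of_nonneg_right (mul_le_mul_of_nonneg_right hNA hβ0.le) h1lβ.le
  have hββ' : β ≤ β' := by
    calc β = 1 * β * 1 := by ring
      _ ≤ A * β * (1 + Real.log β) := by gcongr; linarith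
      _ ≤ β' := hβ'ge
  have hβ'1 : 1 ≤ β' := hβ1.trans hββ'
  have hβ'0 : 0 < β' := lt_of_lt_of_le one_pos hβ'1
  obtain ⟨γc, hγc, hceilc⟩ := hceil L (by omega) β' hβ'1 x
  -- the ceiling value is at most `F/2`
  have hU : 6 * K * (1 + Real.log β') / β' ^ 2 ≤ F / 2 := by
    have hw : 1 + Real.log β' ≤ 2 * (1 + Real.log N) * (1 + Real.log β) := one_add_log_window_le hN1 hβ1
    have hlN : (1 + Real.log N) / N ≤ 3 / M := by
      have h1 : (1 + Real.log N) / N ≤ (1 + Real.log (M ^ 2)) / M ^ 2 :=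
        one_add_log_div_antitone (by nlinarith) hNM
      exact h1.trans (one_add_log_sq_div_sq_le hM1)
    have hlN' : 1 + Real.log N ≤ 3 * N / M := by
      rw [div_le_div_iff₀ hN0 hM0] at hlN
      rw [le_div_iff₀ hM0]; linarith
    have hK72 : 72 * K ≤ c' * M := by
      have := (div_le_iff₀ hc').1 hMK; linarith
    have hlN0 : 0 ≤ Real.log N := Real.log_nonneg hN1
    have hP : 0 ≤ β ^ 2 * (1 + Real.log β) ^ 2 := by positivity
    -- `6K(1+log β') · 2 · (β²(1+log β)) ≤ c' β'²`
    have e : c' * β' ^ 2 = c' * N * (N * (β ^ 2 * (1 + Real.log β) ^ 2)) := by rw [hβ']; ring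
    have hU' : 6 * K * (1 + Real.log β') * (2 * (β ^ 2 * (1 + Real.log β))) ≤ c' * β' ^ 2 :=
      calc 6 * K * (1 + Real.log β') * (2 * (β ^ 2 * (1 + Real.log β)))
          ≤ 6 * K * (2 * (1 + Real.log N) * (1 + Real.log β)) * (2 * (β ^ 2 * (1 + Real.log β))) :=
            mul_le_mul_of_nonneg_right (mul_le_mul_of_nonneg_left hw (by positivity))
              (mul_nonneg two_pos.le (mul_nonneg (sq_nonneg _) h1lβ.le))
        _ = 24 * K * (β ^ 2 * (1 + Real.log β) ^ 2) * (1 + Real.log N) := by ring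
        _ ≤ 24 * K * (β ^ 2 * (1 + Real.log β) ^ 2) * (3 * N / M) :=
            mul_le_mul_of_nonneg_left hlN' (mul_nonneg (by positivity) hP)
        _ = 72 * K * (N * (β ^ 2 * (1 + Real.log β) ^ 2)) / M := by ring
        _ ≤ c' * M * (N * (β ^ 2 * (1 + Real.log β) ^ 2)) / M :=
            div_le_div_of_nonneg_right (mul_le_mul_of_nonneg_right hK72 (mul_nonneg hN0.le hP)) hM0.le
        _ = c' * (1 * (N * (β ^ 2 * (1 + Real.log β) ^ 2))) := by field_simp
        _ ≤ c' * (N * (N * (β ^ 2 * (1 + Real.log β) ^ 2))) :=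
            mul_le_mul_of_nonneg_left (mul_le_mul_of_nonneg_right hN1 (mul_nonneg hN0.le hP)) hc'.le
        _ = c' * β' ^ 2 := by rw [e]; ring
    rw [div_le_iff₀ (pow_pos hβ'0 2), hF,
      show c' / (β ^ 2 * (1 + Real.log β)) / 2 * β' ^ 2 = c' * β' ^ 2 / (2 * (β ^ 2 * (1 + Real.log β))) by
        rw [div_div, div_mul_eq_mul_div, mul_comm (β ^ 2 * (1 + Real.log β)) 2],
      le_div_iff₀ (by positivity)]
    linarith [hU']
  have hle_c : χ γc ≤ F / 2 := by
    have h1 : χ γc ≤ 6 * K * (1 + Real.log β') / β' ^ 2 := hceilc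
    exact h1.trans hU
  have hge_f : F ≤ χ γf := hfloor
  -- order of the two points
  have hfc : γf < γc := by
    have hle : γf ≤ γc := hγf.2.trans (hβ'ge.trans hγc.1)
    rcases hle.eq_or_lt with h | h
    · exfalso; rw [h] at hge_f; linarith
    · exact h
  -- FTC between them and the minimum of `ψ`
  have hint : ∫ γ in γf..γc, ψ γ = χ γc - χ γf := integral_sum_sum_torusK3_eq G r L x γf γc
  have hψc : Continuous ψ := continuous_sum_sum_torusK3 G r L x
  obtain ⟨γm, hγm, hmin⟩ := isCompact_Icc.exists_isMinOn (Set.nonempty_Icc.2 hfc.le) hψc.continuousOn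
  have hlow : (γc - γf) * ψ γm ≤ ∫ γ in γf..γc, ψ γ := by
    calc (γc - γf) * ψ γm = ∫ _γ in γf..γc, ψ γm := by rw [intervalIntegral.integral_const, smul_eq_mul]
      _ ≤ ∫ γ in γf..γc, ψ γ :=
          intervalIntegral.integral_mono_on hfc.le (continuous_const.intervalIntegrable _ _) (hψc.intervalIntegrable _ _)
            fun γ hγ => hmin hγ
  have hneg : (γc - γf) * ψ γm ≤ -(F / 2) := by linarith
  have hlen0 : 0 < γc - γf := by linarith
  have hlen : γc - γf ≤ 2 * β' := by linarith [hγc.2, hγf.1]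
  refine ⟨γm, ⟨hγf.1.trans hγm.1, hγm.2.trans (hγc.2.trans (by rw [hβ']; ring_nf; exact le_rfl))⟩, ?_⟩
  -- `ψ γm ≤ −F/(2(γc − γf)) ≤ −F/(4β')`
  have h1 : ψ γm ≤ -(F / 2) / (γc - γf) := by rwa [le_div_iff₀ hlen0, mul_comm]
  have h2 : -(F / 2) / (γc - γf) ≤ -(F / 2) / (2 * β') := by
    rw [neg_div, neg_div, neg_le_neg_iff]
    exact div_le_div_of_nonneg_left (by positivity) hlen0 hlen
  have h3 : -(F / 2) / (2 * β') = -(c' / (4 * N) / (β ^ 3 * (1 + Real.log β) ^ 2)) := by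
    rw [hF, hβ']; field_simp; ring
  linarith [h1, h2, h3.le, h3.ge]

/-- **Compact simple gauge groups: the sign of the zero-momentum three-point function on every window** (no dimension
hypothesis). [folklore] -/
theorem exists_sum_sum_torusK3_le_window_of_simple (hG : IsCompactSimpleLieGroup G) :
    ∃ c₃ B β₀ : ℝ, 0 < c₃ ∧ 1 ≤ B ∧ 1 ≤ β₀ ∧ ∀ (L : ℕ), 2 ≤ L → ∀ β : ℝ, β₀ ≤ β → ∀ x : Fin 4 → ℤ,
      ∃ γ ∈ Set.Icc β (B * β * (1 + Real.log β)),
        ∑ y ∈ box 4 L, ∑ z ∈ box 4 L, torusK3 G r γ L x y z ≤ -(c₃ / (β ^ 3 * (1 + Real.log β) ^ 2)) :=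
  exists_sum_sum_torusK3_le_window G r (dimE_pos_of_isCompactSimpleLieGroup G r hG)

end Skew

end Summit.QuantumFields.YangMills.Cruxes.NT.LinkEquipartition

end
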